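import Summits.HodgeConjecture.HodgeConjecture.Theorems.F0P3cStCharTSWeylHypMeasure   -- ★ p849733 (LH2-p02 g3) §1: `isRegularElt_coe_torusU_iff`, `isOpen_setOf_isRegularElt_torusU`; brings ★ `CMTorusRegularAEPrelims` (`continuous_coe_torusEntry_inv_mul`)
import Mathlib.Topology.Algebra.ValuativeRel.ValuativeTopology
import HarnessLib

/-!
# F0 · P3c · line LH6 «StCharTS» — ROAD «JAC-LOC» brick «SHIFT-LC★»: the ROOT-UNIT SIZES of a regular diagonal torus element of `U(σ, J)(K)`
# are LOCALLY CONSTANT (ultrametric kernel; Harish-Chandra 1970 Lemma 22, van Dijk 1972 §2, Rogawski 1990 §12.5 p. 182)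

Cell `pub/hodgecm-mathlib`, crux H413 = `stmt-HodgeConjecture-24833` (lane `--supports … --as helper`), route HCCMUnconditional; seat F0P2-p02 (g21), brick
«SHIFT-LC★» of the road «JAC-LOC» (holder LH6-p03 (g5), dealt on bus F0∕P3b 2026-09-02T15:19:58Z; memo `F0/P3b/LH6-p03/g5/ROAD-JAC-LOC.v3.LH6p03g5.md` §1
«root-unit sizes … all in the value group; locally constant in s», §5 «CHOICE OF γ … locally constant in s ∈ t₀T_γ»; consumer (J6) LH6-p04 (g6)).
THEOREMS ONLY, sorry-free, no definition ∕ instance ∕ notation ∕ named fact; imports ★ `…WeylHypMeasure` §1 (regular ⇔ distinct diagonal entries, `T^{reg}` open)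
and Mathlib's valuative topology (`Valuation.locally_const`).

SETTING (the MODEL of ★ (J3) `…VanDijkBox` ∕ ★ (J4c) `…TubeSubsetSandwich`): `K` a field with a valuative relation and its topology (`[ValuativeRel K] [TopologicalSpace K]
[IsValuativeTopology K]`; every non-archimedean local field), `v` ANY compatible valuation (`[v.Compatible]`; e.g. `v := ValuativeRel.valuation K`), `σ : K →+* K`, any form
`J`, `U = ↥(unitaryGroupOfForm σ J)`, `T = torusU σ J` with coordinates `eᵢ = torusEntry σ J i : T →* Kˣ` (on `t = diag(d)`: `eᵢ t = dᵢ`, ★ `torusEntry_eq_of_glDiagonal_eq`).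
For `N = 3` the four ROOT SCALARS of `t = diag(d)` are `a = d₀⁻¹d₁`, `b = d₀⁻¹d₂` (★ (J3)) and, on the opposite side, `a_w = d₂⁻¹d₁`, `b_w = d₂⁻¹d₀` (★ (J3⁻)); their
ROOT-UNIT SIZES are `v(a − 1)`, `v(b − 1)`, `v(a_w − 1)`, `v(b_w − 1)` — the radius scalings of van Dijk's box bijections and the arguments of the tube Jacobian
`D(t) = |det(1 − Ad t)|_{𝔤∕𝔱}|` [HarishChandra1970, Lemma 22].

THE RESULTS.
* §1 (L1) the ULTRAMETRIC KERNEL (any ring, any valuation): **`map_sub_eq_of_map_sub_lt`** `v(x − x₀) < v(x₀ − c) ⇒ v(x − c) = v(x₀ − c)`; at `c = 1`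
  **`map_sub_one_eq_of_map_sub_lt`** and **`ne_one_of_map_sub_lt`** (`⇒ x ≠ 1`).
* §2 (generic valuative topology) **`eventually_map_eq_of_continuousAt`**: `g` continuous at `x₀` with `v(g x₀) ≠ 0` ⇒ `∀ᶠ x in 𝓝 x₀, v(g x) = v(g x₀)` (Mathlib
  `Valuation.locally_const` pulled back); **`eventually_eq_of_continuousAt_of_factorsThrough`** — the same for any function of `K` that factors through `v`
  (hypothesis form: a modulus character, a Jacobian weight).
* §3 (torus, any `N`) **`coe_inv_mul_sub_one_eq_zero_iff`** ∕ **`map_rootScalar_sub_one_ne_zero_iff`** (`v(eᵢ⁻¹eⱼ − 1) ≠ 0 ↔ eᵢ ≠ eⱼ`); **`isRegularElt_iff_forall_torusEntry_ne`**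
  (regular ⇔ pairwise distinct coordinates, ★ `isRegularElt_coe_torusU_iff` over a field); (L2) **`eventually_map_rootScalar_sub_one_eq`**: if `eᵢ t₀ ≠ eⱼ t₀` then
  `∀ᶠ t in 𝓝 t₀, v(eᵢ⁻¹eⱼ(t) − 1) = v(eᵢ⁻¹eⱼ(t₀) − 1)` (and `eᵢ t ≠ eⱼ t`).
* §4 (`N = 3`, `t₀` REGULAR) (L2) **`eventually_isRegularElt_and_rootUnitSizes_eq`**: `∀ᶠ t in 𝓝 t₀` (topology of `T`), `t` is regular AND its four root-unit sizes equal
  those of `t₀`; **`eventually_rootUnitSizes_eq_of_glDiagonal`** — the same in the `d`-writing tokens of ★ (J3)∕(J3⁻)∕(J4c) (`∀ d, glDiagonal 3 K d = ↑t → …` against a fixed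
  writing `d₀` of `t₀`); **`eventually_eq_of_rootUnitSizes`** — hence ANY weight `D : T → M` that depends only on the four sizes (hypothesis `hD`) has `D t = D t₀` near `t₀`;
  (L3) **`exists_isOpen_rootUnitSizes_eq`** — an OPEN `U ∋ t₀` of `T`, `U ⊆ T^{reg}`, on which the four sizes (and such a `D`) are constant — the `U` of ★ p851645's `hJacLoc`;
  (L3′) **`exists_isOpen_ambient_rootUnitSizes_eq`** — the same with an open set of the ambient group `U(σ, J)(K)` (the torus carries the subspace topology).
«Regular is open in `T`» itself is ★ `isOpen_setOf_isRegularElt_torusU` (not restated).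

HONEST LABEL: count-neutral topology∕valuation bookkeeping for the road «JAC-LOC» (hyperbolic half of the print residue «WIF» of the (S-𝔇) organ `stub_EllipticPackage`);
closes no organ.  HC_CM is proved only modulo the 7 printed citations (2 remaining: hLiu418 = `stmt-HodgeConjecture-24832`, h413 = `stmt-HodgeConjecture-24833`) until
rung 0 closes.

## References
* [HarishChandra1970] Harish-Chandra, *Harmonic analysis on reductive p-adic groups*, LNM 162 (1970), Lemma 22 (the Jacobian `|det(1 − Ad t)|_{𝔤∕𝔱}|` is locally constant
  on the regular set).
* [vanDijk1972] G. van Dijk, *Computation of certain induced characters of p-adic groups*, Math. Ann. 199 (1972) 229–240, §2.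
* [Rogawski1990] J. D. Rogawski, *Automorphic Representations of Unitary Groups in Three Variables*, Ann. of Math. Stud. 123 (1990), §1.10 p. 9 (`T`), §3.1 p. 19
  (regular elements), §12.5 p. 182 (Weyl integration formula on the split torus).
-/

set_option autoImplicit false
-- the mandated namespace has the single-problem summit's repeated segment (`HodgeConjecture.HodgeConjecture`)
set_option linter.dupNamespace false

open Filter Topology Set
open Literature.NumberTheory.Automorphic Literature.NumberTheory.Automorphic.UnitaryGroup Literature.NumberTheory.Rogawski1990
open Summit.HodgeConjecture.HodgeConjecture.Cruxes.H413.F0P3cStCharTSWeylHypMeasure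
open scoped MatrixGroups

namespace Summit.HodgeConjecture.HodgeConjecture.Cruxes.H413.F0P3cStCharTSRootUnitLocConst

/-! ## §1 (L1) The ultrametric kernel -/

section Kernel

variable {R : Type*} [Ring R] {Γ₀ : Type*} [LinearOrderedCommGroupWithZero Γ₀] (v : Valuation R Γ₀)

/-- **(L1) ultrametric kernel**: `v(x − x₀) < v(x₀ − c) ⇒ v(x − c) = v(x₀ − c)` (`x − c = (x − x₀) + (x₀ − c)`, Mathlib `Valuation.map_eq_of_sub_lt`).
[cite: HarishChandra1970, Lemma 22] -/
theorem map_sub_eq_of_map_sub_lt {x x₀ c : R} (h : v (x - x₀) < v (x₀ - c)) : v (x - c) = v (x₀ - c) :=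
  Valuation.map_eq_of_sub_lt v (by rwa [sub_sub_sub_cancel_right])

/-- **(L1) at `c = 1`**: `v(x − x₀) < v(x₀ − 1) ⇒ v(x − 1) = v(x₀ − 1)` — the root-unit size does not move inside the ball of radius `v(x₀ − 1)` about `x₀`.
[cite: HarishChandra1970, Lemma 22] [cite: vanDijk1972, §2] -/
theorem map_sub_one_eq_of_map_sub_lt {x x₀ : R} (h : v (x - x₀) < v (x₀ - 1)) : v (x - 1) = v (x₀ - 1) :=
  map_sub_eq_of_map_sub_lt v h

/-- **(L1), consequence**: inside that ball `x ≠ 1` (indeed `v(x − 1) = v(x₀ − 1) > v(x − x₀) ≥ 0`). [cite: HarishChandra1970, Lemma 22] -/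
theorem ne_one_of_map_sub_lt {x x₀ : R} (h : v (x - x₀) < v (x₀ - 1)) : x ≠ 1 := by
  intro hx
  have h1 : v (x - 1) = v (x₀ - 1) := map_sub_one_eq_of_map_sub_lt v h
  rw [hx, sub_self, map_zero] at h1
  exact (ne_zero_of_lt h) h1.symm

end Kernel

/-! ## §2 Local constancy of `v ∘ g` in a valuative topology -/

section LocConst

variable {K : Type*} [CommRing K] [ValuativeRel K] [TopologicalSpace K] [IsValuativeTopology K]
  {Γ₀ : Type*} [LinearOrderedCommGroupWithZero Γ₀] (v : Valuation K Γ₀) [v.Compatible]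

/-- **A continuous `K`-valued function has locally constant valuation off its zero-valuation locus**: `g` continuous at `x₀`, `v(g x₀) ≠ 0` ⇒
`∀ᶠ x in 𝓝 x₀, v(g x) = v(g x₀)` (Mathlib `Valuation.locally_const`, i.e. (L1), pulled back along `g`). [cite: HarishChandra1970, Lemma 22] -/
theorem eventually_map_eq_of_continuousAt {X : Type*} [TopologicalSpace X] {g : X → K} {x₀ : X} (hg : ContinuousAt g x₀)
    (h0 : v (g x₀) ≠ 0) : ∀ᶠ x in 𝓝 x₀, v (g x) = v (g x₀) :=
  hg.preimage_mem_nhds (v.locally_const h0)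

/-- **Hypothesis form for weights**: any `m : K → M` that FACTORS THROUGH `v` (`v y = v y′ ⇒ m y = m y′`; e.g. a modulus character `‖·‖`, a Jacobian weight) is
locally constant along a continuous `g` wherever `v(g x₀) ≠ 0`. [cite: HarishChandra1970, Lemma 22] -/
theorem eventually_eq_of_continuousAt_of_factorsThrough {X M : Type*} [TopologicalSpace X] {g : X → K} {x₀ : X} (hg : ContinuousAt g x₀)
    (h0 : v (g x₀) ≠ 0) (m : K → M) (hm : ∀ y y' : K, v y = v y' → m y = m y') : ∀ᶠ x in 𝓝 x₀, m (g x) = m (g x₀) :=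
  (eventually_map_eq_of_continuousAt v hg h0).mono fun _ hx => hm _ _ hx

end LocConst

/-! ## §3 The diagonal torus of `U(σ, J)(K)`: root scalars, regularity, local constancy of one root-unit size (any `N`) -/

section TorusRing

variable {R : Type*} [CommRing R] (σ : R →+* R) {N : ℕ} {J : Matrix (Fin N) (Fin N) R}

/-- **Root scalar `eᵢ⁻¹eⱼ = 1 ⇔ eᵢ = eⱼ`** (any commutative ring): `(eᵢ(t)⁻¹ eⱼ(t) : R) − 1 = 0 ↔ eᵢ t = eⱼ t`. [cite: Rogawski1990, §3.1 p. 19] -/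
theorem coe_inv_mul_sub_one_eq_zero_iff (t : ↥(torusU σ J)) (i j : Fin N) :
    (((torusEntry σ J i t)⁻¹ * torusEntry σ J j t : Rˣ) : R) - 1 = 0 ↔ torusEntry σ J i t = torusEntry σ J j t := by
  rw [sub_eq_zero, Units.val_eq_one, inv_mul_eq_one]

/-- In `d`-writing tokens (★ (J3)): `(d i)⁻¹ * d j − 1 = 0 ↔ d i = d j`. [cite: Rogawski1990, §3.1 p. 19] -/
theorem coe_inv_mul_sub_one_eq_zero_iff' (d : Fin N → Rˣ) (i j : Fin N) :
    (((d i)⁻¹ * d j : Rˣ) : R) - 1 = 0 ↔ d i = d j := by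
  rw [sub_eq_zero, Units.val_eq_one, inv_mul_eq_one]

end TorusRing

section TorusField

variable {K : Type*} [Field K] {Γ₀ : Type*} [LinearOrderedCommGroupWithZero Γ₀] (v : Valuation K Γ₀)
  (σ : K →+* K) {N : ℕ} {J : Matrix (Fin N) (Fin N) K}

/-- **The root-unit size is non-zero iff the two coordinates differ**: `v(eᵢ(t)⁻¹eⱼ(t) − 1) ≠ 0 ↔ eᵢ t ≠ eⱼ t` (`K` a field). [cite: Rogawski1990, §3.1 p. 19] -/
theorem map_rootScalar_sub_one_ne_zero_iff (t : ↥(torusU σ J)) (i j : Fin N) :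
    v ((((torusEntry σ J i t)⁻¹ * torusEntry σ J j t : Kˣ) : K) - 1) ≠ 0 ↔ torusEntry σ J i t ≠ torusEntry σ J j t := by
  rw [Ne, Valuation.zero_iff, coe_inv_mul_sub_one_eq_zero_iff]

/-- The same in `d`-writing tokens: `v((d i)⁻¹ d j − 1) ≠ 0 ↔ d i ≠ d j`. [cite: Rogawski1990, §3.1 p. 19] -/
theorem map_rootScalar_sub_one_ne_zero_iff' (d : Fin N → Kˣ) (i j : Fin N) :
    v ((((d i)⁻¹ * d j : Kˣ) : K) - 1) ≠ 0 ↔ d i ≠ d j := by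
  rw [Ne, Valuation.zero_iff, coe_inv_mul_sub_one_eq_zero_iff']

/-- **Regular ⇔ pairwise distinct coordinates** on the torus over a field (★ `isRegularElt_coe_torusU_iff` with `x ≠ 0 ⇒ IsUnit x`).
[cite: Rogawski1990, §3.1 p. 19; §12.5 p. 182] -/
theorem isRegularElt_iff_forall_torusEntry_ne (t : ↥(torusU σ J)) :
    IsRegularElt (((t : ↥(unitaryGroupOfForm σ J)) : GL (Fin N) K)) ↔ ∀ i j : Fin N, i ≠ j → torusEntry σ J i t ≠ torusEntry σ J j t := by
  rw [isRegularElt_coe_torusU_iff σ J (fun x hx => isUnit_iff_ne_zero.2 hx) t]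
  refine forall_congr' fun i => forall_congr' fun j => forall_congr' fun _ => ?_
  rw [sub_ne_zero, Ne, Ne, Units.val_inj]

/-- **Regular ⇒ every root-unit size is non-zero** (`i ≠ j`). [cite: Rogawski1990, §3.1 p. 19] -/
theorem map_rootScalar_sub_one_ne_zero_of_isRegularElt (t : ↥(torusU σ J))
    (hreg : IsRegularElt (((t : ↥(unitaryGroupOfForm σ J)) : GL (Fin N) K))) {i j : Fin N} (hij : i ≠ j) :
    v ((((torusEntry σ J i t)⁻¹ * torusEntry σ J j t : Kˣ) : K) - 1) ≠ 0 :=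
  (map_rootScalar_sub_one_ne_zero_iff v σ t i j).2 ((isRegularElt_iff_forall_torusEntry_ne σ t).1 hreg i j hij)

end TorusField

section TorusValued

variable {K : Type*} [Field K] [ValuativeRel K] [TopologicalSpace K] [IsValuativeTopology K]
  {Γ₀ : Type*} [LinearOrderedCommGroupWithZero Γ₀] (v : Valuation K Γ₀) [v.Compatible]
  (σ : K →+* K) {N : ℕ} {J : Matrix (Fin N) (Fin N) K}

/-- **(L2), one root (any `N`)**: if `eᵢ t₀ ≠ eⱼ t₀` then `∀ᶠ t in 𝓝 t₀` (topology of `T`) the root-unit size `v(eᵢ⁻¹eⱼ(t) − 1)` equals its value at `t₀`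
(§2 along the continuous coordinate ratio ★ `continuous_coe_torusEntry_inv_mul`). [cite: HarishChandra1970, Lemma 22] [cite: Rogawski1990, §12.5 p. 182] -/
theorem eventually_map_rootScalar_sub_one_eq (t₀ : ↥(torusU σ J)) {i j : Fin N} (h : torusEntry σ J i t₀ ≠ torusEntry σ J j t₀) :
    ∀ᶠ t in 𝓝 t₀, v ((((torusEntry σ J i t)⁻¹ * torusEntry σ J j t : Kˣ) : K) - 1) =
      v ((((torusEntry σ J i t₀)⁻¹ * torusEntry σ J j t₀ : Kˣ) : K) - 1) :=
  eventually_map_eq_of_continuousAt v (g := fun t : ↥(torusU σ J) => (((torusEntry σ J i t)⁻¹ * torusEntry σ J j t : Kˣ) : K) - 1)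
    ((continuous_coe_torusEntry_inv_mul σ J i j).sub continuous_const).continuousAt ((map_rootScalar_sub_one_ne_zero_iff v σ t₀ i j).2 h)

/-- **(L2), one root, with distinctness**: near `t₀` the size is that of `t₀` AND `eᵢ t ≠ eⱼ t`. [cite: HarishChandra1970, Lemma 22] -/
theorem eventually_map_rootScalar_sub_one_eq_and_ne (t₀ : ↥(torusU σ J)) {i j : Fin N} (h : torusEntry σ J i t₀ ≠ torusEntry σ J j t₀) :
    ∀ᶠ t in 𝓝 t₀, v ((((torusEntry σ J i t)⁻¹ * torusEntry σ J j t : Kˣ) : K) - 1) =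
      v ((((torusEntry σ J i t₀)⁻¹ * torusEntry σ J j t₀ : Kˣ) : K) - 1) ∧ torusEntry σ J i t ≠ torusEntry σ J j t := by
  refine (eventually_map_rootScalar_sub_one_eq v σ t₀ h).mono fun t ht => ⟨ht, ?_⟩
  rw [← map_rootScalar_sub_one_ne_zero_iff v σ t i j, ht]
  exact (map_rootScalar_sub_one_ne_zero_iff v σ t₀ i j).2 h

end TorusValued

/-! ## §4 `N = 3`: the four root-unit sizes of a regular `t₀` are locally constant; the open set of ★ `hJacLoc` -/

section Three

variable {K : Type*} [Field K] [ValuativeRel K] [TopologicalSpace K] [IsValuativeTopology K]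
  {Γ₀ : Type*} [LinearOrderedCommGroupWithZero Γ₀] (v : Valuation K Γ₀) [v.Compatible]
  (σ : K →+* K) {J : Matrix (Fin 3) (Fin 3) K}

/-- **(L2) «SHIFT-LC»**: for a REGULAR `t₀ ∈ T` (`N = 3`), eventually in `𝓝 t₀` (topology of the torus) `t` is REGULAR and its four root-unit sizes
`v(a − 1)`, `v(b − 1)`, `v(a_w − 1)`, `v(b_w − 1)` (`a = e₀⁻¹e₁`, `b = e₀⁻¹e₂`, `a_w = e₂⁻¹e₁`, `b_w = e₂⁻¹e₀`) equal those of `t₀`.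
[cite: HarishChandra1970, Lemma 22] [cite: vanDijk1972, §2] [cite: Rogawski1990, §12.5 p. 182] -/
theorem eventually_isRegularElt_and_rootUnitSizes_eq (t₀ : ↥(torusU σ J)) (hreg : IsRegularElt (((t₀ : ↥(unitaryGroupOfForm σ J)) : GL (Fin 3) K))) :
    ∀ᶠ t : ↥(torusU σ J) in 𝓝 t₀, IsRegularElt (((t : ↥(unitaryGroupOfForm σ J)) : GL (Fin 3) K)) ∧
      v ((((torusEntry σ J 0 t)⁻¹ * torusEntry σ J 1 t : Kˣ) : K) - 1) = v ((((torusEntry σ J 0 t₀)⁻¹ * torusEntry σ J 1 t₀ : Kˣ) : K) - 1) ∧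
      v ((((torusEntry σ J 0 t)⁻¹ * torusEntry σ J 2 t : Kˣ) : K) - 1) = v ((((torusEntry σ J 0 t₀)⁻¹ * torusEntry σ J 2 t₀ : Kˣ) : K) - 1) ∧
      v ((((torusEntry σ J 2 t)⁻¹ * torusEntry σ J 1 t : Kˣ) : K) - 1) = v ((((torusEntry σ J 2 t₀)⁻¹ * torusEntry σ J 1 t₀ : Kˣ) : K) - 1) ∧
      v ((((torusEntry σ J 2 t)⁻¹ * torusEntry σ J 0 t : Kˣ) : K) - 1) = v ((((torusEntry σ J 2 t₀)⁻¹ * torusEntry σ J 0 t₀ : Kˣ) : K) - 1) := by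
  have hne := (isRegularElt_iff_forall_torusEntry_ne σ t₀).1 hreg
  have h01 := eventually_map_rootScalar_sub_one_eq_and_ne v σ t₀ (hne 0 1 (by decide))
  have h02 := eventually_map_rootScalar_sub_one_eq_and_ne v σ t₀ (hne 0 2 (by decide))
  have h21 := eventually_map_rootScalar_sub_one_eq_and_ne v σ t₀ (hne 2 1 (by decide))
  have h20 := eventually_map_rootScalar_sub_one_eq_and_ne v σ t₀ (hne 2 0 (by decide))
  filter_upwards [h01, h02, h21, h20] with t ht01 ht02 ht21 ht20
  refine ⟨(isRegularElt_iff_forall_torusEntry_ne σ t).2 ?_, ht01.1, ht02.1, ht21.1, ht20.1⟩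
  intro i j hij
  fin_cases i <;> fin_cases j
  · exact absurd rfl hij
  · exact ht01.2
  · exact ht02.2
  · exact ht01.2.symm
  · exact absurd rfl hij
  · exact ht21.2.symm
  · exact ht20.2
  · exact ht21.2
  · exact absurd rfl hij

/-- **(L2) in the `d`-writing tokens of ★ (J3)∕(J3⁻)∕(J4c)**: fix a writing `glDiagonal 3 K d₀ = ↑t₀` of the regular `t₀`; then eventually in `𝓝 t₀`, for EVERY writing
`glDiagonal 3 K d = ↑t`, `t` is regular and `v(d₀⁻¹d₁ − 1)`, `v(d₀⁻¹d₂ − 1)`, `v(d₂⁻¹d₁ − 1)`, `v(d₂⁻¹d₀ − 1)` at `d` equal the same expressions at `d₀`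
(★ `torusEntry_eq_of_glDiagonal_eq`). [cite: HarishChandra1970, Lemma 22] [cite: vanDijk1972, §2] -/
theorem eventually_rootUnitSizes_eq_of_glDiagonal (t₀ : ↥(torusU σ J)) (hreg : IsRegularElt (((t₀ : ↥(unitaryGroupOfForm σ J)) : GL (Fin 3) K)))
    {d₀ : Fin 3 → Kˣ} (hd₀ : glDiagonal 3 K d₀ = ((t₀ : ↥(unitaryGroupOfForm σ J)) : GL (Fin 3) K)) :
    ∀ᶠ t : ↥(torusU σ J) in 𝓝 t₀, ∀ d : Fin 3 → Kˣ, glDiagonal 3 K d = ((t : ↥(unitaryGroupOfForm σ J)) : GL (Fin 3) K) →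
      IsRegularElt (((t : ↥(unitaryGroupOfForm σ J)) : GL (Fin 3) K)) ∧
      v ((((d 0)⁻¹ * d 1 : Kˣ) : K) - 1) = v ((((d₀ 0)⁻¹ * d₀ 1 : Kˣ) : K) - 1) ∧
      v ((((d 0)⁻¹ * d 2 : Kˣ) : K) - 1) = v ((((d₀ 0)⁻¹ * d₀ 2 : Kˣ) : K) - 1) ∧
      v ((((d 2)⁻¹ * d 1 : Kˣ) : K) - 1) = v ((((d₀ 2)⁻¹ * d₀ 1 : Kˣ) : K) - 1) ∧
      v ((((d 2)⁻¹ * d 0 : Kˣ) : K) - 1) = v ((((d₀ 2)⁻¹ * d₀ 0 : Kˣ) : K) - 1) := by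
  have h0 : ∀ i, torusEntry σ J i t₀ = d₀ i := fun i => torusEntry_eq_of_glDiagonal_eq σ J i t₀ d₀ hd₀
  filter_upwards [eventually_isRegularElt_and_rootUnitSizes_eq v σ t₀ hreg] with t ht d hd
  have h1 : ∀ i, torusEntry σ J i t = d i := fun i => torusEntry_eq_of_glDiagonal_eq σ J i t d hd
  simp only [h0, h1] at ht
  exact ht

/-- **(L2) for weights**: ANY `D : T → M` that depends only on the four root-unit sizes on the regular set (hypothesis `hD`; e.g. the tube Jacobian
`D(t) = |det(1 − Ad t)|_{𝔤∕𝔱}|` of ★ (J7), a product of modulus characters of the four root units) satisfies `D t = D t₀` near a regular `t₀`.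
[cite: HarishChandra1970, Lemma 22] [cite: Rogawski1990, §12.5 p. 182] -/
theorem eventually_eq_of_rootUnitSizes {M : Type*} (D : ↥(torusU σ J) → M)
    (hD : ∀ t t' : ↥(torusU σ J), IsRegularElt (((t : ↥(unitaryGroupOfForm σ J)) : GL (Fin 3) K)) →
      IsRegularElt (((t' : ↥(unitaryGroupOfForm σ J)) : GL (Fin 3) K)) →
      v ((((torusEntry σ J 0 t)⁻¹ * torusEntry σ J 1 t : Kˣ) : K) - 1) = v ((((torusEntry σ J 0 t')⁻¹ * torusEntry σ J 1 t' : Kˣ) : K) - 1) →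
      v ((((torusEntry σ J 0 t)⁻¹ * torusEntry σ J 2 t : Kˣ) : K) - 1) = v ((((torusEntry σ J 0 t')⁻¹ * torusEntry σ J 2 t' : Kˣ) : K) - 1) →
      v ((((torusEntry σ J 2 t)⁻¹ * torusEntry σ J 1 t : Kˣ) : K) - 1) = v ((((torusEntry σ J 2 t')⁻¹ * torusEntry σ J 1 t' : Kˣ) : K) - 1) →
      v ((((torusEntry σ J 2 t)⁻¹ * torusEntry σ J 0 t : Kˣ) : K) - 1) = v ((((torusEntry σ J 2 t')⁻¹ * torusEntry σ J 0 t' : Kˣ) : K) - 1) →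
      D t = D t')
    (t₀ : ↥(torusU σ J)) (hreg : IsRegularElt (((t₀ : ↥(unitaryGroupOfForm σ J)) : GL (Fin 3) K))) :
    ∀ᶠ t : ↥(torusU σ J) in 𝓝 t₀, D t = D t₀ := by
  filter_upwards [eventually_isRegularElt_and_rootUnitSizes_eq v σ t₀ hreg] with t ht
  exact hD t t₀ ht.1 hreg ht.2.1 ht.2.2.1 ht.2.2.2.1 ht.2.2.2.2

/-- **(L3) «SHIFT-LC», open-set form** (the `U` of ★ p851645's `hJacLoc`): around a REGULAR `t₀ ∈ T` there is an OPEN `U ∋ t₀` of the torus, contained in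
`T^{reg}`, on which the four root-unit sizes are CONSTANT (equal to those of `t₀`). [cite: HarishChandra1970, Lemma 22] [cite: Rogawski1990, §12.5 p. 182] -/
theorem exists_isOpen_rootUnitSizes_eq (t₀ : ↥(torusU σ J)) (hreg : IsRegularElt (((t₀ : ↥(unitaryGroupOfForm σ J)) : GL (Fin 3) K))) :
    ∃ U : Set ↥(torusU σ J), IsOpen U ∧ t₀ ∈ U ∧ ∀ t : ↥(torusU σ J), t ∈ U →
      IsRegularElt (((t : ↥(unitaryGroupOfForm σ J)) : GL (Fin 3) K)) ∧
      v ((((torusEntry σ J 0 t)⁻¹ * torusEntry σ J 1 t : Kˣ) : K) - 1) = v ((((torusEntry σ J 0 t₀)⁻¹ * torusEntry σ J 1 t₀ : Kˣ) : K) - 1) ∧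
      v ((((torusEntry σ J 0 t)⁻¹ * torusEntry σ J 2 t : Kˣ) : K) - 1) = v ((((torusEntry σ J 0 t₀)⁻¹ * torusEntry σ J 2 t₀ : Kˣ) : K) - 1) ∧
      v ((((torusEntry σ J 2 t)⁻¹ * torusEntry σ J 1 t : Kˣ) : K) - 1) = v ((((torusEntry σ J 2 t₀)⁻¹ * torusEntry σ J 1 t₀ : Kˣ) : K) - 1) ∧
      v ((((torusEntry σ J 2 t)⁻¹ * torusEntry σ J 0 t : Kˣ) : K) - 1) = v ((((torusEntry σ J 2 t₀)⁻¹ * torusEntry σ J 0 t₀ : Kˣ) : K) - 1) := by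
  obtain ⟨U, hU, hUo, ht₀⟩ := mem_nhds_iff.1 (eventually_isRegularElt_and_rootUnitSizes_eq v σ t₀ hreg)
  exact ⟨U, hUo, ht₀, fun t ht => hU ht⟩

/-- **(L3) with a weight**: the same open `U ∋ t₀`, on which additionally any size-determined `D : T → M` (hypothesis `hD` of `eventually_eq_of_rootUnitSizes`) is constant.
[cite: HarishChandra1970, Lemma 22] [cite: Rogawski1990, §12.5 p. 182] -/
theorem exists_isOpen_rootUnitSizes_eq_and_eq {M : Type*} (D : ↥(torusU σ J) → M)
    (hD : ∀ t t' : ↥(torusU σ J), IsRegularElt (((t : ↥(unitaryGroupOfForm σ J)) : GL (Fin 3) K)) →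
      IsRegularElt (((t' : ↥(unitaryGroupOfForm σ J)) : GL (Fin 3) K)) →
      v ((((torusEntry σ J 0 t)⁻¹ * torusEntry σ J 1 t : Kˣ) : K) - 1) = v ((((torusEntry σ J 0 t')⁻¹ * torusEntry σ J 1 t' : Kˣ) : K) - 1) →
      v ((((torusEntry σ J 0 t)⁻¹ * torusEntry σ J 2 t : Kˣ) : K) - 1) = v ((((torusEntry σ J 0 t')⁻¹ * torusEntry σ J 2 t' : Kˣ) : K) - 1) →
      v ((((torusEntry σ J 2 t)⁻¹ * torusEntry σ J 1 t : Kˣ) : K) - 1) = v ((((torusEntry σ J 2 t')⁻¹ * torusEntry σ J 1 t' : Kˣ) : K) - 1) →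
      v ((((torusEntry σ J 2 t)⁻¹ * torusEntry σ J 0 t : Kˣ) : K) - 1) = v ((((torusEntry σ J 2 t')⁻¹ * torusEntry σ J 0 t' : Kˣ) : K) - 1) →
      D t = D t')
    (t₀ : ↥(torusU σ J)) (hreg : IsRegularElt (((t₀ : ↥(unitaryGroupOfForm σ J)) : GL (Fin 3) K))) :
    ∃ U : Set ↥(torusU σ J), IsOpen U ∧ t₀ ∈ U ∧ ∀ t : ↥(torusU σ J), t ∈ U →
      IsRegularElt (((t : ↥(unitaryGroupOfForm σ J)) : GL (Fin 3) K)) ∧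
      v ((((torusEntry σ J 0 t)⁻¹ * torusEntry σ J 1 t : Kˣ) : K) - 1) = v ((((torusEntry σ J 0 t₀)⁻¹ * torusEntry σ J 1 t₀ : Kˣ) : K) - 1) ∧
      v ((((torusEntry σ J 0 t)⁻¹ * torusEntry σ J 2 t : Kˣ) : K) - 1) = v ((((torusEntry σ J 0 t₀)⁻¹ * torusEntry σ J 2 t₀ : Kˣ) : K) - 1) ∧
      v ((((torusEntry σ J 2 t)⁻¹ * torusEntry σ J 1 t : Kˣ) : K) - 1) = v ((((torusEntry σ J 2 t₀)⁻¹ * torusEntry σ J 1 t₀ : Kˣ) : K) - 1) ∧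
      v ((((torusEntry σ J 2 t)⁻¹ * torusEntry σ J 0 t : Kˣ) : K) - 1) = v ((((torusEntry σ J 2 t₀)⁻¹ * torusEntry σ J 0 t₀ : Kˣ) : K) - 1) ∧
      D t = D t₀ := by
  obtain ⟨U, hU, hUo, ht₀⟩ := mem_nhds_iff.1
    ((eventually_isRegularElt_and_rootUnitSizes_eq v σ t₀ hreg).and (eventually_eq_of_rootUnitSizes v σ D hD t₀ hreg))
  exact ⟨U, hUo, ht₀, fun t ht => ⟨(hU ht).1.1, (hU ht).1.2.1, (hU ht).1.2.2.1, (hU ht).1.2.2.2.1, (hU ht).1.2.2.2.2, (hU ht).2⟩⟩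

/-- **(L3′) ambient form**: the torus carries the subspace topology of `U(σ, J)(K)`, so the open set of (L3) is cut out by an OPEN set `O` of the ambient
group: `∃ O` open, `↑t₀ ∈ O`, and every `t ∈ T` with `↑t ∈ O` is regular with the four root-unit sizes of `t₀`. [cite: HarishChandra1970, Lemma 22] -/
theorem exists_isOpen_ambient_rootUnitSizes_eq (t₀ : ↥(torusU σ J)) (hreg : IsRegularElt (((t₀ : ↥(unitaryGroupOfForm σ J)) : GL (Fin 3) K))) :
    ∃ O : Set ↥(unitaryGroupOfForm σ J), IsOpen O ∧ (t₀ : ↥(unitaryGroupOfForm σ J)) ∈ O ∧ ∀ t : ↥(torusU σ J), (t : ↥(unitaryGroupOfForm σ J)) ∈ O →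
      IsRegularElt (((t : ↥(unitaryGroupOfForm σ J)) : GL (Fin 3) K)) ∧
      v ((((torusEntry σ J 0 t)⁻¹ * torusEntry σ J 1 t : Kˣ) : K) - 1) = v ((((torusEntry σ J 0 t₀)⁻¹ * torusEntry σ J 1 t₀ : Kˣ) : K) - 1) ∧
      v ((((torusEntry σ J 0 t)⁻¹ * torusEntry σ J 2 t : Kˣ) : K) - 1) = v ((((torusEntry σ J 0 t₀)⁻¹ * torusEntry σ J 2 t₀ : Kˣ) : K) - 1) ∧
      v ((((torusEntry σ J 2 t)⁻¹ * torusEntry σ J 1 t : Kˣ) : K) - 1) = v ((((torusEntry σ J 2 t₀)⁻¹ * torusEntry σ J 1 t₀ : Kˣ) : K) - 1) ∧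
      v ((((torusEntry σ J 2 t)⁻¹ * torusEntry σ J 0 t : Kˣ) : K) - 1) = v ((((torusEntry σ J 2 t₀)⁻¹ * torusEntry σ J 0 t₀ : Kˣ) : K) - 1) := by
  obtain ⟨U, hUo, ht₀, hU⟩ := exists_isOpen_rootUnitSizes_eq v σ t₀ hreg
  obtain ⟨O, hOo, hOU⟩ := isOpen_induced_iff.1 hUo
  refine ⟨O, hOo, ?_, fun t ht => hU t ?_⟩
  · rw [← hOU] at ht₀; exact ht₀
  · rw [← hOU]; exact ht

end Three

end Summit.HodgeConjecture.HodgeConjecture.Cruxes.H413.F0P3cStCharTSRootUnitLocConst
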